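import Summits.CriticalPhenomena.PercolationContinuityZ3.Theorems.PercAnnulusCrossingIICPivotalEdges
import HarnessLib

/-!
# Pivotal edges of the IIC root are as thin as the backbone: `Σ_{u∼v in Λ(r)} ν(s(u,v) pivotal) ≤ C (2r+1)^d π(r)²` (lane RSW3, p1 gen 12)

builds on p205010 (kernel theorem, internal audit signed; external expert review pending) — used at `p_c(ℤ^d)` through the (A2)□ bridge (p1 gen 11's
`…IICPivotalEdges`, p2 gen 19's `Rsw3.exists_sum_tau_le_of_setToSetQuasiMultAspectAt`).

RSW3 lane (LANE 3 `prim-rsw3`), seat `prim-rsw3-p1` (gen 12); memo `run/shared/lean/prim/rsw3/P1-QM.md` §25 (closing §24.4 agenda item (c)).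
Helper file for the crux `stmt-CriticalPhenomena-4575` chain; no definitions, no sorries.

p1 gen 11 (K, `iicMeasure_real_pivotal_le_criticalProbI`): `ν(s(u,v) pivotal for the root) ≤ C₁ (τ(0,u) + τ(0,v))`.  Summing over the ordered adjacent
pairs of `Λ(r)` with the combinatorial bound `Σ_{u∈S} Σ_{v∈S, v∼u} (g u + g v) ≤ 4d Σ_{v∈S} g v` (every site has `2d` neighbours) and p2's hyperscaling sum
`Σ_{Λ(r)} τ_{p_c}(0,z) ≤ C₂ (2r+1)^d π_{p_c}(r)²`:

* `sum_sum_filter_adj_add_le` — the double-counting bound;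
* **`iicMeasure_sum_real_pivotal_le_criticalProbI`** — at `p_c(ℤ^d)`, `d ≥ 2`, under (A2)□ at aspect `(s,L)` (`2 ≤ s ≤ L`): ONE `C` with
  **`Σ_{u ∈ Λ(r)} Σ_{v ∈ Λ(r), v ∼ u} ν(ω ∖ {s(u,v)} ∉ {0 ↔ ∞}) ≤ C (2r+1)^d π_{p_c}(r)²`** for every IIC measure `ν` and every `r ≥ 1` — the MEAN NUMBER OF PIVOTAL
  EDGES of the root inside `Λ(r)` is `O((2r+1)^d π(r)²)`, the order of the backbone volume (`…IICBackboneThin`), against the IIC volume `≍ (2r+1)^d π(r)`;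
  `…_Z2` unconditional.
References: H. Kesten, PTRF 73 (1986) §3 (planar backbone/pivotals); D. Basu, A. Sapozhnikov, ECP 22 (2017) no. 26; G. Grimmett, *Percolation* (1999) §2.4.
-/

noncomputable section

namespace Summit.CriticalPhenomena.PercolationContinuityZ3.Theorems.Crossing

open MeasureTheory ProbabilityTheory Filter Topology
open Literature.Probability.Percolation Literature.Probability.LatticeModels
open Literature.Probability.Percolation.DCT16
open scoped ENNReal ProbabilityTheory

variable {d : ℕ}

open Classical in
/-- **Double counting over adjacent pairs**: for `g ≥ 0` and any finite `S ⊆ ℤ^d`,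
`Σ_{u ∈ S} Σ_{v ∈ S, u ∼ v} (g u + g v) ≤ 4d · Σ_{v ∈ S} g v` (each site has `2d` lattice neighbours). [folklore] -/
theorem sum_sum_filter_adj_add_le (S : Finset (Site d)) {g : Site d → ℝ} (hg : ∀ v, 0 ≤ g v) :
    ∑ u ∈ S, ∑ v ∈ S.filter (fun v => (zdGraph d).Adj u v), (g u + g v) ≤ 4 * d * ∑ v ∈ S, g v := by
  have hcard : ∀ u : Site d, ((S.filter (fun v => (zdGraph d).Adj u v)).card : ℝ) ≤ 2 * d := by
    intro u
    have h1 : (S.filter (fun v => (zdGraph d).Adj u v)).card ≤ ((zdGraph d).neighborFinset u).card :=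
      Finset.card_le_card fun v hv => (SimpleGraph.mem_neighborFinset _ _ _).2 (Finset.mem_filter.1 hv).2
    rw [card_neighborFinset_zdGraph_holds] at h1
    exact_mod_cast h1
  -- first half: `Σ_u Σ_{v∼u} g u = Σ_u g u · #{v ∈ S : u ∼ v} ≤ 2d Σ_u g u`
  have hA : ∑ u ∈ S, ∑ v ∈ S.filter (fun v => (zdGraph d).Adj u v), g u ≤ 2 * d * ∑ u ∈ S, g u := by
    rw [Finset.mul_sum]
    refine Finset.sum_le_sum fun u _ => ?_
    rw [Finset.sum_const, nsmul_eq_mul]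
    calc ((S.filter (fun v => (zdGraph d).Adj u v)).card : ℝ) * g u ≤ 2 * d * g u :=
        mul_le_mul_of_nonneg_right (hcard u) (hg u)
      _ = 2 * d * g u := rfl
  -- second half: swap the sums using the symmetry of adjacency
  have hB : ∑ u ∈ S, ∑ v ∈ S.filter (fun v => (zdGraph d).Adj u v), g v ≤ 2 * d * ∑ v ∈ S, g v := by
    have hswap : ∑ u ∈ S, ∑ v ∈ S.filter (fun v => (zdGraph d).Adj u v), g v =
        ∑ v ∈ S, ∑ u ∈ S.filter (fun u => (zdGraph d).Adj v u), g v := by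
      rw [Finset.sum_comm' (t' := S) (s' := fun v => S.filter (fun u => (zdGraph d).Adj v u))]
      intro u v
      simp only [Finset.mem_filter]
      constructor
      · rintro ⟨hu, hv, huv⟩; exact ⟨⟨hu, huv.symm⟩, hv⟩
      · rintro ⟨⟨hu, hvu⟩, hv⟩; exact ⟨hu, hv, hvu.symm⟩
    rw [hswap, Finset.mul_sum]
    refine Finset.sum_le_sum fun v _ => ?_
    rw [Finset.sum_const, nsmul_eq_mul]
    exact mul_le_mul_of_nonneg_right (hcard v) (hg v)
  rw [show (4 : ℝ) * d * ∑ v ∈ S, g v = 2 * d * ∑ u ∈ S, g u + 2 * d * ∑ v ∈ S, g v by ring]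
  calc ∑ u ∈ S, ∑ v ∈ S.filter (fun v => (zdGraph d).Adj u v), (g u + g v)
      = ∑ u ∈ S, ∑ v ∈ S.filter (fun v => (zdGraph d).Adj u v), g u +
          ∑ u ∈ S, ∑ v ∈ S.filter (fun v => (zdGraph d).Adj u v), g v := by
        rw [← Finset.sum_add_distrib]
        exact Finset.sum_congr rfl fun u _ => Finset.sum_add_distrib
    _ ≤ _ := add_le_add hA hB

open Classical in
/-- **THE MEAN NUMBER OF PIVOTAL EDGES OF THE IIC ROOT IN `Λ(r)` IS `O((2r+1)^d π(r)²)`**: at `p_c(ℤ^d)`, `d ≥ 2`, under (A2)□ at aspect `(s,L)`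
(`2 ≤ s ≤ L`, `ϰ > 0`) there is `C > 0` such that for every IIC measure `ν` and every `r ≥ 1`:
**`Σ_{u ∈ Λ(r)} Σ_{v ∈ Λ(r), v ∼ u} ν(ω ∖ {s(u,v)} ∉ {|C(0)| = ∞}) ≤ C · (2r+1)^d · π_{p_c}(r)²`** — pivotal edges are as thin as the backbone
(`…IICBackboneThin`: backbone volume `≤ C(2r+1)^dπ(r)²`) inside an IIC of volume `≍ (2r+1)^d π(r)` (closing P1-QM §24.4 agenda (c)).
[cite: Kesten1986, §3] [cite: BasuSapozhnikov2017ECP, Thm. 1.1] -/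
theorem iicMeasure_sum_real_pivotal_le_criticalProbI (hd : 2 ≤ d) {s L : ℕ} (hs : 2 ≤ s) (hsL : s ≤ L) {ϰ : ℝ} (hϰ : 0 < ϰ)
    (hA2 : SetToSetQuasiMultAspectAt d (criticalProbI d) s L ϰ) :
    ∃ C : ℝ, 0 < C ∧ ∀ (ν : Measure (BondConfig (Site d))) [IsProbabilityMeasure ν],
      (∀ (F : Finset (Sym2 (Site d))) (E : Set (BondConfig (Site d))), MeasurableSet E → DeterminedBy E ↑F →
        Tendsto (fun n : ℕ => (bondPercolation (zdGraph d) (criticalProbI d)).real (E ∩ siteToBoundary d n) /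
          oneArmProb d (criticalProbI d) n) atTop (𝓝 (ν.real E))) →
      ∀ r : ℕ, 1 ≤ r →
        ∑ u ∈ box d r, ∑ v ∈ (box d r).filter (fun v => (zdGraph d).Adj u v),
            ν.real {ω : BondConfig (Site d) | ω \ {s(u, v)} ∉ percolatesAt (0 : Site d)} ≤
          C * ((2 * (r : ℝ) + 1) ^ d * oneArmProb d (criticalProbI d) r ^ 2) := by
  obtain ⟨C₁, hC₁, hpiv⟩ := iicMeasure_real_pivotal_le_criticalProbI hd hs hsL hϰ hA2
  obtain ⟨C₂, hC₂, hτ⟩ := Rsw3.exists_sum_tau_le_of_setToSetQuasiMultAspectAt hd hs hsL hϰ hA2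
  refine ⟨C₁ * (4 * d) * C₂, by positivity, fun ν _ hν r hr => ?_⟩
  set P := bondPercolation (zdGraph d) (criticalProbI d) with hP
  have hg : ∀ v : Site d, 0 ≤ P.real (openConn (0 : Site d) v) := fun v => measureReal_nonneg
  calc ∑ u ∈ box d r, ∑ v ∈ (box d r).filter (fun v => (zdGraph d).Adj u v),
          ν.real {ω : BondConfig (Site d) | ω \ {s(u, v)} ∉ percolatesAt (0 : Site d)}
      ≤ ∑ u ∈ box d r, ∑ v ∈ (box d r).filter (fun v => (zdGraph d).Adj u v),
          C₁ * (P.real (openConn (0 : Site d) u) + P.real (openConn (0 : Site d) v)) :=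
        Finset.sum_le_sum fun u _ => Finset.sum_le_sum fun v _ => hpiv ν hν u v
    _ = C₁ * ∑ u ∈ box d r, ∑ v ∈ (box d r).filter (fun v => (zdGraph d).Adj u v),
          (P.real (openConn (0 : Site d) u) + P.real (openConn (0 : Site d) v)) := by
        rw [Finset.mul_sum]; refine Finset.sum_congr rfl fun u _ => ?_; rw [Finset.mul_sum]
    _ ≤ C₁ * (4 * d * ∑ v ∈ box d r, P.real (openConn (0 : Site d) v)) :=
        mul_le_mul_of_nonneg_left (sum_sum_filter_adj_add_le (box d r) hg) hC₁.le
    _ = C₁ * (4 * d) * ∑ v ∈ box d r, tau d (criticalProbI d) 0 v := by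
        have hsum : ∑ v ∈ box d r, P.real (openConn (0 : Site d) v) = ∑ v ∈ box d r, tau d (criticalProbI d) 0 v :=
          Finset.sum_congr rfl fun v _ => (tau_def (criticalProbI d) 0 v).symm
        rw [hsum]; ring
    _ ≤ C₁ * (4 * d) * (C₂ * ((2 * (r : ℝ) + 1) ^ d * oneArmProb d (criticalProbI d) r ^ 2)) :=
        mul_le_mul_of_nonneg_left (hτ r hr) (by positivity)
    _ = C₁ * (4 * d) * C₂ * ((2 * (r : ℝ) + 1) ^ d * oneArmProb d (criticalProbI d) r ^ 2) := by ring

open Classical in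
/-- **Pivotal edges of the planar IIC root in `Λ(r)`: mean number `≤ C (2r+1)² π_{1/2}(r)²`** (unconditional). [cite: Kesten1986, §3] -/
theorem iicMeasure_sum_real_pivotal_le_Z2 :
    ∃ C : ℝ, 0 < C ∧ ∀ (ν : Measure (BondConfig (Site 2))) [IsProbabilityMeasure ν],
      (∀ (F : Finset (Sym2 (Site 2))) (E : Set (BondConfig (Site 2))), MeasurableSet E → DeterminedBy E ↑F →
        Tendsto (fun n : ℕ => (bondPercolation (zdGraph 2) (criticalProbI 2)).real (E ∩ siteToBoundary 2 n) /
          oneArmProb 2 (criticalProbI 2) n) atTop (𝓝 (ν.real E))) →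
      ∀ r : ℕ, 1 ≤ r →
        ∑ u ∈ box 2 r, ∑ v ∈ (box 2 r).filter (fun v => (zdGraph 2).Adj u v),
            ν.real {ω : BondConfig (Site 2) | ω \ {s(u, v)} ∉ percolatesAt (0 : Site 2)} ≤
          C * ((2 * (r : ℝ) + 1) ^ 2 * oneArmProb 2 (criticalProbI 2) r ^ 2) := by
  obtain ⟨ϰ, hϰ, hA2⟩ := exists_setToSetQuasiMultAspectAt_two_of_criticalProbI_le
  exact iicMeasure_sum_real_pivotal_le_criticalProbI (d := 2) le_rfl (s := 9) (L := 77) (by norm_num) (by norm_num) hϰ (hA2 _ le_rfl)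

end Summit.CriticalPhenomena.PercolationContinuityZ3.Theorems.Crossing

end
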